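import Summits.CriticalPhenomena.PercolationContinuityZ3.Theorems.PercNearOneGluingNoHeavyLowerTailAPLProfileEdgePhi
import HarnessLib

/-!
# `NoHeavyLowerTail` (stmt-CriticalPhenomena-4575) — the ADMISSIBLE FAMILY of profile rows, part 1: the generalised Φ-inequality and propagation (analytic core of the proof of APL-G for all finite weighted graphs)

Support file (prover prim-ineq-gen-8 gen 38; `--supports stmt-CriticalPhenomena-4575`; memo
run/shared/lean/prim/prim-ineq-gen-8/FINDING-gen38-APLG-ALL.md §1).  Pure real algebra: no definitions, no named facts, no sorries.

SETTING.  Gen 37 proved the PROFILE row `U⁶ ≤ A²B³C³` (APL-P) for every finite weighted graph and every glued apex set by an induction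
over one apex edge at a time whose only analytic input is LEMMA Q (`…APLProfileEdgePhi`, `…APLProfileEdgeAnalytic`).  The same induction proves the
whole one-parameter FAMILY of rows `U^{α+β} ≤ A·B^β·C^α` for every ADMISSIBLE pair of exponents
  `α ≥ 1`, `β ≥ 1`, `αβ(α+β+1) ≥ (α+β)²`
(APL-P is `(3/2,3/2)`; the boundary members are `β = (s²+3)/(s²−1)`, `α = (s²+3)/(2(s+1))`, `s ≥ 3`), once LEMMA Q is generalised; and the family
implies gen 29's APL-G `(TD − e)² ≤ u_ab·u_ac` — hence the quantitative Gladkov–Zimin Conjecture 6.3 — for every finite weighted graph (memo §2,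
file `…APLGeometricAll`).  This file is the exponent-generic analogue of `…APLProfileEdgePhi`:
* `famQ_nonneg` — the quadratic form `Q_{αβ}(p,q) = α(α−1)p² + 2(αβ−α−β)pq + β(β−1)q²` is nonnegative for admissible `(α,β)`
  (`α(α−1)·Q = (α(α−1)p + (αβ−α−β)q)² + (αβ(α+β+1) − (α+β)²)q²`);
* `phi_edge_identity` — with `Φ(y) = y/(1−yδ)`, `T' = αp + βq`, `s = p + q`:
  `[Φ(T') + βΦ(p) + αΦ(q) − (α+β)Φ(s)]·(1−sδ)(1−T'δ)(1−pδ)(1−qδ) = δ·[Q(1−pδ)(1−qδ) + βpq(1−qδ)δ(T'−p) + αpq(1−pδ)δ(T'−q)]`;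
* **`phi_ineq_fam`** — the generalised Φ-INEQUALITY `Φ((α+β)x − βp − αq) + βΦ(p) + αΦ(q) ≥ (α+β)Φ(x)` for `x ≥ p + q ≥ 0`;
* **`psi_propagate_fam`** — PROPAGATION: `ψ(z₁) ≥ 0 ⟹ ψ(z) ≥ 0` for `z ≥ z₁`, `ψ = −(α+β)φ_U + φ_A + βφ_B + αφ_C` (given ROW Π `φ_U ≥ φ_B + φ_C` at `z₁`).
Part 2 (`…APLFamilyEdge.lean`) turns this into LEMMA Q_{αβ} by the mean value theorem. [this work]
-/

namespace Summit.CriticalPhenomena.PercolationContinuityZ3.Theorems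

namespace APL

/-! ### The quadratic form of an admissible pair of exponents -/

/-- For an admissible pair (`α, β ≥ 1`, `αβ(α+β+1) ≥ (α+β)²`) one has `α > 1`. [this work] -/
theorem fam_one_lt_alpha (α β : ℝ) (hα : 1 ≤ α) (hadm : (α + β) ^ 2 ≤ α * β * (α + β + 1)) : 1 < α := by
  by_contra h
  push Not at h
  have hα1 : α = 1 := le_antisymm h hα
  subst hα1
  nlinarith

/-- For an admissible pair one has `β > 1`. [this work] -/
theorem fam_one_lt_beta (α β : ℝ) (hβ : 1 ≤ β) (hadm : (α + β) ^ 2 ≤ α * β * (α + β + 1)) : 1 < β := by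
  by_contra h
  push Not at h
  have hβ1 : β = 1 := le_antisymm h hβ
  subst hβ1
  nlinarith

/-- **The form `Q_{αβ}` is nonnegative** for an admissible pair: `α(α−1)p² + 2(αβ−α−β)pq + β(β−1)q² ≥ 0` for all real `p, q`
(`α(α−1)·Q = (α(α−1)p + (αβ−α−β)q)² + (αβ(α+β+1) − (α+β)²)·q²`). [this work] -/
theorem famQ_nonneg (α β p q : ℝ) (hα : 1 ≤ α) (hadm : (α + β) ^ 2 ≤ α * β * (α + β + 1)) :
    0 ≤ α * (α - 1) * p ^ 2 + 2 * (α * β - α - β) * (p * q) + β * (β - 1) * q ^ 2 := by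
  have hα' := fam_one_lt_alpha α β hα hadm
  have ha : 0 < α * (α - 1) := mul_pos (by linarith) (by linarith)
  have key : α * (α - 1) * (α * (α - 1) * p ^ 2 + 2 * (α * β - α - β) * (p * q) + β * (β - 1) * q ^ 2)
      = (α * (α - 1) * p + (α * β - α - β) * q) ^ 2 + (α * β * (α + β + 1) - (α + β) ^ 2) * q ^ 2 := by ring
  have h2 : 0 ≤ (α * (α - 1) * p + (α * β - α - β) * q) ^ 2 + (α * β * (α + β + 1) - (α + β) ^ 2) * q ^ 2 := by
    have h3 : 0 ≤ (α * β * (α + β + 1) - (α + β) ^ 2) * q ^ 2 := mul_nonneg (by linarith) (sq_nonneg q)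
    nlinarith [sq_nonneg (α * (α - 1) * p + (α * β - α - β) * q)]
  rw [← key] at h2
  by_contra hneg
  push Not at hneg
  nlinarith [mul_neg_of_pos_of_neg ha hneg]

/-! ### The generalised Φ-inequality -/

/-- The edge identity (the case `x = p + q` of the Φ-inequality in closed form): with `T' = αp + βq`, `s = p + q`,
`[Φ(T') + βΦ(p) + αΦ(q) − (α+β)Φ(s)]·(1−sδ)(1−T'δ)(1−pδ)(1−qδ) = δ·[Q_{αβ}(p,q)(1−pδ)(1−qδ) + βpq(1−qδ)δ(T'−p) + αpq(1−pδ)δ(T'−q)]`.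
[this work] -/
theorem phi_edge_identity (α β δ p q : ℝ) (hs : 1 - (p + q) * δ ≠ 0) (hT : 1 - (α * p + β * q) * δ ≠ 0)
    (hp : 1 - p * δ ≠ 0) (hq : 1 - q * δ ≠ 0) :
    ((α * p + β * q) / (1 - (α * p + β * q) * δ) + β * (p / (1 - p * δ)) + α * (q / (1 - q * δ))
        - (α + β) * ((p + q) / (1 - (p + q) * δ)))
      * ((1 - (p + q) * δ) * (1 - (α * p + β * q) * δ) * (1 - p * δ) * (1 - q * δ))
      = δ * ((α * (α - 1) * p ^ 2 + 2 * (α * β - α - β) * (p * q) + β * (β - 1) * q ^ 2) * (1 - p * δ) * (1 - q * δ)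
          + β * p * q * (1 - q * δ) * δ * ((α * p + β * q) - p) + α * p * q * (1 - p * δ) * δ * ((α * p + β * q) - q)) := by
  rw [div_eq_mul_inv, div_eq_mul_inv, div_eq_mul_inv, div_eq_mul_inv]
  have e1 : (1 - (p + q) * δ) * (1 - (p + q) * δ)⁻¹ = 1 := mul_inv_cancel₀ hs
  have e2 : (1 - (α * p + β * q) * δ) * (1 - (α * p + β * q) * δ)⁻¹ = 1 := mul_inv_cancel₀ hT
  have e3 : (1 - p * δ) * (1 - p * δ)⁻¹ = 1 := mul_inv_cancel₀ hp
  have e4 : (1 - q * δ) * (1 - q * δ)⁻¹ = 1 := mul_inv_cancel₀ hq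
  linear_combination
    ((α * p + β * q) * ((1 - (p + q) * δ) * (1 - p * δ) * (1 - q * δ))) * e2
    + (β * p * ((1 - (p + q) * δ) * (1 - (α * p + β * q) * δ) * (1 - q * δ))) * e3
    + (α * q * ((1 - (p + q) * δ) * (1 - (α * p + β * q) * δ) * (1 - p * δ))) * e4
    - ((α + β) * (p + q) * ((1 - (α * p + β * q) * δ) * (1 - p * δ) * (1 - q * δ))) * e1

/-- **The generalised Φ-inequality.**  For an admissible pair `(α,β)`, `δ ≥ 0`, `p, q ≥ 0`, `x ≥ p + q` and `T = (α+β)x − βp − αq` with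
`Tδ < 1`:  `Φ(T) + βΦ(p) + αΦ(q) ≥ (α+β)Φ(x)`, `Φ(y) = y/(1−yδ)`.  Proof: at `x = s := p+q` this is `phi_edge_identity` (every term on the
right is `≥ 0` by `famQ_nonneg` and `p, q ≤ αp+βq`); for `x ≥ s`, `Φ(T) − Φ(αp+βq) = (α+β)(x−s)/((1−(αp+βq)δ)(1−Tδ)) ≥ (α+β)(Φ(x) − Φ(s))`
by the slope formula, since `αp+βq ≥ s` and `T ≥ x`.  For `(3/2,3/2)` this is gen 37's `phi_ineq`. [this work] -/
theorem phi_ineq_fam (α β δ p q x : ℝ) (hα : 1 ≤ α) (hβ : 1 ≤ β) (hadm : (α + β) ^ 2 ≤ α * β * (α + β + 1))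
    (hδ : 0 ≤ δ) (hp : 0 ≤ p) (hq : 0 ≤ q) (hx : p + q ≤ x)
    (hT : ((α + β) * x - β * p - α * q) * δ < 1) :
    (α + β) * (x / (1 - x * δ)) ≤ ((α + β) * x - β * p - α * q) / (1 - ((α + β) * x - β * p - α * q) * δ)
      + β * (p / (1 - p * δ)) + α * (q / (1 - q * δ)) := by
  -- the comparison points `s = p + q ≤ x` and `T' = αp + βq ≤ T`
  have hα0 : 0 ≤ α := zero_le_one.trans hα
  have hβ0 : 0 ≤ β := zero_le_one.trans hβ
  have hap : 0 ≤ (α - 1) * p := mul_nonneg (sub_nonneg.2 hα) hp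
  have hbq : 0 ≤ (β - 1) * q := mul_nonneg (sub_nonneg.2 hβ) hq
  have hTp_s : p + q ≤ α * p + β * q := by linarith
  have hT'p : p ≤ α * p + β * q := by nlinarith [mul_nonneg hβ0 hq]
  have hT'q : q ≤ α * p + β * q := by nlinarith [mul_nonneg hα0 hp]
  have hTT' : (α + β) * x - β * p - α * q = (α * p + β * q) + (α + β) * (x - (p + q)) := by ring
  have hT_T' : α * p + β * q ≤ (α + β) * x - β * p - α * q := by
    rw [hTT']
    have : 0 ≤ (α + β) * (x - (p + q)) := mul_nonneg (add_nonneg hα0 hβ0) (sub_nonneg.2 hx)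
    linarith
  have hT_x : x ≤ (α + β) * x - β * p - α * q := by
    have : 0 ≤ (α + β - 1) * (x - (p + q)) := mul_nonneg (by linarith) (sub_nonneg.2 hx)
    nlinarith
  -- positivity of all denominators (the largest argument is `T`)
  have dT : 0 < 1 - ((α + β) * x - β * p - α * q) * δ := by linarith
  have dT' : 0 < 1 - (α * p + β * q) * δ := by
    have := mul_le_mul_of_nonneg_right hT_T' hδ; linarith
  have dx : 0 < 1 - x * δ := by
    have := mul_le_mul_of_nonneg_right hT_x hδ; linarith
  have ds : 0 < 1 - (p + q) * δ := by
    have := mul_le_mul_of_nonneg_right hx hδ; linarith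
  have dp : 0 < 1 - p * δ := by
    have := mul_nonneg hq hδ; linarith
  have dq : 0 < 1 - q * δ := by
    have := mul_nonneg hp hδ; linarith
  -- (i) the edge case `x = s`
  have hQ := famQ_nonneg α β p q hα hadm
  have hE1 : 0 ≤ (α * p + β * q) / (1 - (α * p + β * q) * δ) + β * (p / (1 - p * δ)) + α * (q / (1 - q * δ))
      - (α + β) * ((p + q) / (1 - (p + q) * δ)) := by
    have hden : 0 < (1 - (p + q) * δ) * (1 - (α * p + β * q) * δ) * (1 - p * δ) * (1 - q * δ) :=
      mul_pos (mul_pos (mul_pos ds dT') dp) dq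
    have hrhs : 0 ≤ δ * ((α * (α - 1) * p ^ 2 + 2 * (α * β - α - β) * (p * q) + β * (β - 1) * q ^ 2) * (1 - p * δ) * (1 - q * δ)
          + β * p * q * (1 - q * δ) * δ * ((α * p + β * q) - p) + α * p * q * (1 - p * δ) * δ * ((α * p + β * q) - q)) := by
      have h1 : 0 ≤ (α * (α - 1) * p ^ 2 + 2 * (α * β - α - β) * (p * q) + β * (β - 1) * q ^ 2) * (1 - p * δ) * (1 - q * δ) :=
        mul_nonneg (mul_nonneg hQ dp.le) dq.le
      have h2 : 0 ≤ β * p * q * (1 - q * δ) * δ * ((α * p + β * q) - p) :=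
        mul_nonneg (mul_nonneg (mul_nonneg (mul_nonneg (mul_nonneg (by linarith) hp) hq) dq.le) hδ) (sub_nonneg.2 hT'p)
      have h3 : 0 ≤ α * p * q * (1 - p * δ) * δ * ((α * p + β * q) - q) :=
        mul_nonneg (mul_nonneg (mul_nonneg (mul_nonneg (mul_nonneg (by linarith) hp) hq) dp.le) hδ) (sub_nonneg.2 hT'q)
      exact mul_nonneg hδ (by linarith)
    have hid := phi_edge_identity α β δ p q ds.ne' dT'.ne' dp.ne' dq.ne'
    rw [← hid] at hrhs
    by_contra hneg
    push Not at hneg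
    linarith [mul_neg_of_neg_of_pos hneg hden, hrhs]
  -- (ii) the interior step `x ≥ s`
  have hE2 : (α + β) * (x / (1 - x * δ) - (p + q) / (1 - (p + q) * δ))
      ≤ ((α + β) * x - β * p - α * q) / (1 - ((α + β) * x - β * p - α * q) * δ) - (α * p + β * q) / (1 - (α * p + β * q) * δ) := by
    rw [phi_slope δ (p + q) x ds.ne' dx.ne', phi_slope δ (α * p + β * q) ((α + β) * x - β * p - α * q) dT'.ne' dT.ne']
    have e2 : (α + β) * x - β * p - α * q - (α * p + β * q) = (α + β) * (x - (p + q)) := by ring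
    rw [e2]
    have hD : (1 - (α * p + β * q) * δ) * (1 - ((α + β) * x - β * p - α * q) * δ) ≤ (1 - (p + q) * δ) * (1 - x * δ) := by
      apply mul_le_mul _ _ dT.le ds.le
      · nlinarith [mul_le_mul_of_nonneg_right hTp_s hδ]
      · nlinarith [mul_le_mul_of_nonneg_right hT_x hδ]
    have hD1 : 0 < (1 - (α * p + β * q) * δ) * (1 - ((α + β) * x - β * p - α * q) * δ) := mul_pos dT' dT
    have hn : 0 ≤ (α + β) * (x - (p + q)) := mul_nonneg (by linarith) (sub_nonneg.2 hx)
    rw [show (α + β) * ((x - (p + q)) / ((1 - (p + q) * δ) * (1 - x * δ))) = (α + β) * (x - (p + q)) / ((1 - (p + q) * δ) * (1 - x * δ)) by ring]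
    exact div_le_div_of_nonneg_left hn hD1 hD
  -- assemble
  linarith [hE1, hE2]

/-! ### Propagation -/

/-- **Propagation.**  With `x = Φ_{z₁}(π₀)`, `a = Φ_{z₁}(π_A)`, `p = Φ_{z₁}(π_B)`, `q = Φ_{z₁}(π_C)` already evaluated at `z₁`:
if `x ≥ p + q ≥ 0` and `ψ(z₁) = −(α+β)x + a + βp + αq ≥ 0`, then for every `δ ≥ 0` with `aδ < 1`,
`−(α+β)Φ_δ(x) + Φ_δ(a) + βΦ_δ(p) + αΦ_δ(q) ≥ 0`. [this work] -/
theorem psi_propagate_fam (α β δ x a p q : ℝ) (hα : 1 ≤ α) (hβ : 1 ≤ β) (hadm : (α + β) ^ 2 ≤ α * β * (α + β + 1))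
    (hδ : 0 ≤ δ) (hp : 0 ≤ p) (hq : 0 ≤ q) (hx : p + q ≤ x)
    (hψ : 0 ≤ -(α + β) * x + a + β * p + α * q) (ha : a * δ < 1) :
    0 ≤ -(α + β) * (x / (1 - x * δ)) + a / (1 - a * δ) + β * (p / (1 - p * δ)) + α * (q / (1 - q * δ)) := by
  have hTa : (α + β) * x - β * p - α * q ≤ a := by linarith
  have hT : ((α + β) * x - β * p - α * q) * δ < 1 := lt_of_le_of_lt (mul_le_mul_of_nonneg_right hTa hδ) ha
  have h1 := phi_ineq_fam α β δ p q x hα hβ hadm hδ hp hq hx hT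
  have h2 : ((α + β) * x - β * p - α * q) / (1 - ((α + β) * x - β * p - α * q) * δ) ≤ a / (1 - a * δ) :=
    phi_mono δ _ _ hδ hTa (by linarith)
  linarith

end APL

end Summit.CriticalPhenomena.PercolationContinuityZ3.Theorems
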